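import Literature.Computability.MetaComplexity.KDNFResolution
import HarnessLib

/-!
# The `Res(k)` rung for expanding linear systems, III: shallow decision trees for DNFs

Support file for `stmt-PneNP-11443`. The deterministic half of the Segerlind–Buss–Impagliazzo
switching argument, phrased without a decision-tree datatype:

* `Ev F α h` ("the DNF `F` has a STRONG decision tree of height `≤ h` over the partial assignment
  `α`"): inductively, either some term of `F` is satisfied by `α` (a `1`-leaf), or every consistent
  term of `F` is falsified by `α` (a `0`-leaf), or some unassigned variable `x` is queried and both
  extensions have strong trees of height `≤ h - 1`;
* monotonicity in the height and under extension of the assignment (`Ev.mono`, `Ev.of_extends`);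
* QUERYING A SET: if every way of filling in the unassigned variables of a finite set `C` yields a
  strong tree of height `≤ h`, then there is one of height `≤ h + |C|` (`ev_of_forall_fillIn`);
* RESTRICTING BY A COVER: for a total assignment `β` of `C`, the DNF `restrictDNF β C F` (drop the
  terms falsified on `C`, delete the `C`-literals of the others) has strong trees that are strong
  trees of `F` over any `α` agreeing with `β` on `C` (`Ev.of_restrictDNF`), and it is a
  `(k-1)`-DNF when every consistent term of the `k`-DNF `F` meets `C` (`isKDNF_restrictDNF`);
* the COVER DICHOTOMY (`exists_disjoint_or_cover`): a DNF without the empty term either has `s`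
  pairwise variable-disjoint consistent terms, or a set of fewer than `k s` variables meeting
  every consistent term.

[Segerlind–Buss–Impagliazzo 2004, §3 (switching lemma for small restrictions: covers vs.
disjoint terms); Alekhnovich 2011, §4]
-/

namespace Summit.PneNP.PneNP.Theorems.ResKRestriction

open Finset Literature.Computability.Complexity Literature.Computability.MetaComplexity

/-! ### Terms under partial assignments -/

/-- The variables of a term. [folklore] -/
def tvars (t : Finset (Literal ℕ)) : Finset ℕ :=
  t.image Prod.fst

/-- Membership in `tvars`. [folklore] -/
theorem mem_tvars {t : Finset (Literal ℕ)} {x : ℕ} : x ∈ tvars t ↔ ∃ b, (x, b) ∈ t := by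
  constructor
  · intro h
    obtain ⟨l, hl, rfl⟩ := Finset.mem_image.1 h
    exact ⟨l.2, hl⟩
  · rintro ⟨b, hb⟩
    exact Finset.mem_image.2 ⟨(x, b), hb, rfl⟩

/-- `|tvars t| ≤ |t|`. [folklore] -/
theorem card_tvars_le (t : Finset (Literal ℕ)) : (tvars t).card ≤ t.card :=
  Finset.card_image_le

/-- A term is CONSISTENT if it contains no complementary pair of literals. [folklore] -/
def TConsistent (t : Finset (Literal ℕ)) : Prop :=
  ∀ l ∈ t, l.negate ∉ t

/-- Consistency of a term is decidable. [folklore] -/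
instance (t : Finset (Literal ℕ)) : Decidable (TConsistent t) := by
  unfold TConsistent; infer_instance

/-- The partial assignment `α` SATISFIES the term `t`: every literal of `t` is assigned and true.
[Segerlind–Buss–Impagliazzo 2004, §2] [folklore] -/
def SatBy (α : ℕ → Option Bool) (t : Finset (Literal ℕ)) : Prop :=
  ∀ l ∈ t, α l.1 = some l.2

/-- The partial assignment `α` FALSIFIES the term `t`: some literal of `t` is assigned and false.
[Segerlind–Buss–Impagliazzo 2004, §2] [folklore] -/
def FalsBy (α : ℕ → Option Bool) (t : Finset (Literal ℕ)) : Prop :=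
  ∃ l ∈ t, α l.1 = some (!l.2)

/-- `β` EXTENDS `α`: every variable assigned by `α` is assigned the same value by `β`. [folklore] -/
def Extends (α β : ℕ → Option Bool) : Prop :=
  ∀ x b, α x = some b → β x = some b

/-- `Extends` is reflexive. [folklore] -/
theorem Extends.rfl {α : ℕ → Option Bool} : Extends α α := fun _ _ h => h

/-- `Extends` is transitive. [folklore] -/
theorem Extends.trans {α β γ : ℕ → Option Bool} (h₁ : Extends α β) (h₂ : Extends β γ) :
    Extends α γ := fun x b h => h₂ x b (h₁ x b h)

/-- Assigning an unassigned variable extends the assignment. [folklore] -/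
theorem extends_update {α : ℕ → Option Bool} {x : ℕ} (hx : α x = none) (b : Bool) :
    Extends α (Function.update α x (some b)) := by
  intro y b' hy
  rw [Function.update_of_ne]
  · exact hy
  · rintro rfl; rw [hx] at hy; exact absurd hy (by simp)

/-- Updating both sides at the same variable preserves extension. [folklore] -/
theorem Extends.update {α β : ℕ → Option Bool} (h : Extends α β) (x : ℕ) (o : Option Bool) :
    Extends (Function.update α x o) (Function.update β x o) := by
  intro y b hy
  by_cases hyx : y = x
  · subst hyx; rw [Function.update_self] at hy ⊢; exact hy
  · rw [Function.update_of_ne hyx] at hy ⊢; exact h y b hy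

/-- If `β` already assigns `x := b`, then `β` extends `α[x := b]` whenever it extends `α`. [folklore] -/
theorem Extends.update_left {α β : ℕ → Option Bool} (h : Extends α β) {x : ℕ} {b : Bool}
    (hb : β x = some b) : Extends (Function.update α x (some b)) β := by
  intro y b' hy
  by_cases hyx : y = x
  · subst hyx; rw [Function.update_self] at hy; cases hy; exact hb
  · rw [Function.update_of_ne hyx] at hy; exact h y b' hy

/-- Satisfaction is preserved under extension. [folklore] -/
theorem SatBy.mono {α β : ℕ → Option Bool} {t : Finset (Literal ℕ)} (h : SatBy α t)
    (hαβ : Extends α β) : SatBy β t := fun l hl => hαβ _ _ (h l hl)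

/-- Falsification is preserved under extension. [folklore] -/
theorem FalsBy.mono {α β : ℕ → Option Bool} {t : Finset (Literal ℕ)} (h : FalsBy α t)
    (hαβ : Extends α β) : FalsBy β t := by
  obtain ⟨l, hl, hαl⟩ := h
  exact ⟨l, hl, hαβ _ _ hαl⟩

/-- A satisfied term is not falsified. [folklore] -/
theorem SatBy.not_falsBy {α : ℕ → Option Bool} {t : Finset (Literal ℕ)} (h : SatBy α t) :
    ¬ FalsBy α t := by
  rintro ⟨l, hl, hαl⟩
  have := h l hl
  rw [this] at hαl
  cases hb : l.2 <;> simp [hb] at hαl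

/-- A satisfied term is consistent. [folklore] -/
theorem SatBy.tconsistent {α : ℕ → Option Bool} {t : Finset (Literal ℕ)} (h : SatBy α t) :
    TConsistent t := by
  intro l hl hneg
  have h1 := h l hl
  have h2 := h _ hneg
  simp only [Literal.negate] at h2
  rw [h1] at h2
  cases hb : l.2 <;> simp [hb] at h2

/-! ### Strong decision trees, as an inductive predicate -/

/-- `Ev F α h`: the DNF `F` has a strong decision tree of height at most `h` over the partial
assignment `α` — a `1`-leaf (some term satisfied), a `0`-leaf (every consistent term falsified),
or a query of an unassigned variable with strong subtrees of height `≤ h - 1` on both answers.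
[Segerlind–Buss–Impagliazzo 2004, §2 (decision trees strongly representing a DNF)] [folklore] -/
inductive Ev (F : Finset (Finset (Literal ℕ))) : (ℕ → Option Bool) → ℕ → Prop
  /-- a `1`-leaf -/
  | one {α : ℕ → Option Bool} {h : ℕ} (t : Finset (Literal ℕ)) (ht : t ∈ F) (hs : SatBy α t) : Ev F α h
  /-- a `0`-leaf -/
  | zero {α : ℕ → Option Bool} {h : ℕ} (hf : ∀ t ∈ F, TConsistent t → FalsBy α t) : Ev F α h
  /-- a query node -/
  | query {α : ℕ → Option Bool} {h : ℕ} (x : ℕ) (hx : α x = none)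
      (h0 : Ev F (Function.update α x (some false)) h)
      (h1 : Ev F (Function.update α x (some true)) h) : Ev F α (h + 1)

variable {F : Finset (Finset (Literal ℕ))}

/-- Monotonicity in the height. [folklore] -/
theorem Ev.mono {α : ℕ → Option Bool} {h h' : ℕ} (hev : Ev F α h) (hh : h ≤ h') : Ev F α h' := by
  induction hev generalizing h' with
  | one t ht hs => exact Ev.one t ht hs
  | zero hf => exact Ev.zero hf
  | @query α h x hx _ _ ih0 ih1 =>
    obtain ⟨d, rfl⟩ : ∃ d, h' = (h + d) + 1 := ⟨h' - h - 1, by omega⟩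
    exact Ev.query x hx (ih0 (by omega)) (ih1 (by omega))

/-- **Restricting a strong tree**: a strong tree over `α` gives one (of no larger height) over
any extension `β` (follow `β`'s answer at queried variables it assigns). [Segerlind–Buss–Impagliazzo
2004, §2] [folklore] -/
theorem Ev.of_extends {α β : ℕ → Option Bool} {h : ℕ} (hev : Ev F α h) (hαβ : Extends α β) :
    Ev F β h := by
  induction hev generalizing β with
  | one t ht hs => exact Ev.one t ht (hs.mono hαβ)
  | zero hf => exact Ev.zero fun t ht hc => (hf t ht hc).mono hαβ
  | query x hx _ _ ih0 ih1 =>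
    cases hβ : β x with
    | none => exact Ev.query x hβ (ih0 (hαβ.update x _)) (ih1 (hαβ.update x _))
    | some b =>
      cases b with
      | false => exact (ih0 (hαβ.update_left hβ)).mono (Nat.le_succ _)
      | true => exact (ih1 (hαβ.update_left hβ)).mono (Nat.le_succ _)

/-- The DNF containing the empty term is everywhere `1`. [folklore] -/
theorem ev_of_empty_mem (hF : (∅ : Finset (Literal ℕ)) ∈ F) (α : ℕ → Option Bool) (h : ℕ) :
    Ev F α h :=
  Ev.one ∅ hF (by simp [SatBy])

/-! ### Querying all unassigned variables of a set -/

/-- Fill in the unassigned variables of `C` according to `π`. [folklore] -/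
def fillIn (α : ℕ → Option Bool) (C : Finset ℕ) (π : ℕ → Bool) : ℕ → Option Bool :=
  fun x => if x ∈ C then (match α x with | some b => some b | none => some (π x)) else α x

/-- Filling in the empty set does nothing. [folklore] -/
theorem fillIn_empty (α : ℕ → Option Bool) (π : ℕ → Bool) : fillIn α ∅ π = α := by
  funext x; simp [fillIn]

/-- Filling in `insert x C` at an assigned `x` is filling in `C`. [folklore] -/
theorem fillIn_insert_of_some {α : ℕ → Option Bool} {C : Finset ℕ} {x : ℕ} {b : Bool}
    (hx : α x = some b) (π : ℕ → Bool) : fillIn α (insert x C) π = fillIn α C π := by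
  funext y
  by_cases hyx : y = x
  · subst hyx
    by_cases hyC : y ∈ C <;> simp [fillIn, hyC, hx]
  · simp [fillIn, hyx]

/-- Filling in `insert x C` at an unassigned `x` is: assign `x := π x`, then fill in `C`. [folklore] -/
theorem fillIn_insert_of_none {α : ℕ → Option Bool} {C : Finset ℕ} {x : ℕ} (hx : α x = none)
    (hxC : x ∉ C) (π : ℕ → Bool) :
    fillIn α (insert x C) π = fillIn (Function.update α x (some (π x))) C π := by
  funext y
  by_cases hyx : y = x
  · subst hyx
    simp [fillIn, hx, hxC]
  · simp [fillIn, hyx]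

/-- **Querying a set of variables**: if every fill-in of the unassigned variables of `C` gives a
strong tree of height `≤ h`, then there is one of height `≤ h + |C|`.
[Segerlind–Buss–Impagliazzo 2004, §3 (query the cover)] [folklore] -/
theorem ev_of_forall_fillIn {α : ℕ → Option Bool} {h : ℕ} (C : Finset ℕ)
    (hC : ∀ π : ℕ → Bool, Ev F (fillIn α C π) h) : Ev F α (h + C.card) := by
  induction C using Finset.induction_on generalizing α with
  | empty => simpa [fillIn_empty] using hC fun _ => false
  | @insert x C hxC ih =>
    rw [Finset.card_insert_of_notMem hxC]
    cases hx : α x with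
    | some b =>
      have : Ev F α (h + C.card) := ih fun π => by rw [← fillIn_insert_of_some hx π]; exact hC π
      exact this.mono (by omega)
    | none =>
      have hb : ∀ b : Bool, Ev F (Function.update α x (some b)) (h + C.card) := by
        intro b
        refine ih fun π => ?_
        have := hC (Function.update π x b)
        rw [fillIn_insert_of_none hx hxC] at this
        simp only [Function.update_self] at this
        -- `fillIn` only reads `π` on `C`, where `update π x b = π`
        have heq : fillIn (Function.update α x (some b)) C (Function.update π x b) =
            fillIn (Function.update α x (some b)) C π := by
          funext y
          by_cases hyx : y = x
          · subst hyx; simp [fillIn, hxC]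
          · simp [fillIn, Function.update_of_ne hyx]
        rwa [heq] at this
      have := Ev.query x hx (hb false) (hb true)
      exact this.mono (by omega)

/-! ### Restricting a DNF on a set of variables -/

/-- `restrictDNF β C F`: restrict the DNF `F` by the total assignment `β` on the variable set `C` —
keep the consistent terms not falsified by `β` on `C`, and delete their literals on `C` (which `β`
satisfies). [Segerlind–Buss–Impagliazzo 2004, §3] [folklore] -/
def restrictDNF (β : ℕ → Bool) (C : Finset ℕ) (F : Finset (Finset (Literal ℕ))) :
    Finset (Finset (Literal ℕ)) :=
  (F.filter fun t => TConsistent t ∧ ∀ l ∈ t, l.1 ∈ C → β l.1 = l.2).image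
    fun t => t.filter fun l => l.1 ∉ C

/-- `α` AGREES with `β` on `C`: `α` assigns every variable of `C`, with `β`'s value. [folklore] -/
def AgreesOn (α : ℕ → Option Bool) (β : ℕ → Bool) (C : Finset ℕ) : Prop :=
  ∀ x ∈ C, α x = some (β x)

/-- Agreement on `C` survives assigning a variable that was unassigned (hence outside `C`). [folklore] -/
theorem AgreesOn.update {α : ℕ → Option Bool} {β : ℕ → Bool} {C : Finset ℕ} (h : AgreesOn α β C)
    {x : ℕ} (hx : α x = none) (o : Option Bool) : AgreesOn (Function.update α x o) β C := by
  intro y hy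
  rw [Function.update_of_ne]
  · exact h y hy
  · rintro rfl; rw [h y hy] at hx; exact absurd hx (by simp)

/-- **Strong trees of the restricted DNF are strong trees of the DNF** over assignments agreeing
with `β` on `C`. [Segerlind–Buss–Impagliazzo 2004, §3] [folklore] -/
theorem Ev.of_restrictDNF {β : ℕ → Bool} {C : Finset ℕ} {α : ℕ → Option Bool} {h : ℕ}
    (hev : Ev (restrictDNF β C F) α h) (hα : AgreesOn α β C) : Ev F α h := by
  -- generalize the restricted DNF to run the induction
  generalize hG : restrictDNF β C F = G at hev
  induction hev with
  | @one α h t' ht' hs =>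
    subst hG
    obtain ⟨t, ht, rfl⟩ := Finset.mem_image.1 ht'
    rw [Finset.mem_filter] at ht
    obtain ⟨htF, -, hβt⟩ := ht
    refine Ev.one t htF fun l hl => ?_
    by_cases hlC : l.1 ∈ C
    · rw [hα l.1 hlC, hβt l hl hlC]
    · exact hs l (Finset.mem_filter.2 ⟨hl, hlC⟩)
  | @zero α h hf =>
    subst hG
    refine Ev.zero fun t htF htc => ?_
    by_cases hβt : ∀ l ∈ t, l.1 ∈ C → β l.1 = l.2
    · have ht' : (t.filter fun l => l.1 ∉ C) ∈ restrictDNF β C F :=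
        Finset.mem_image.2 ⟨t, Finset.mem_filter.2 ⟨htF, htc, hβt⟩, rfl⟩
      have htc' : TConsistent (t.filter fun l => l.1 ∉ C) := fun l hl hneg =>
        htc l (Finset.mem_filter.1 hl).1 (Finset.mem_filter.1 hneg).1
      obtain ⟨l, hl, hαl⟩ := hf _ ht' htc'
      exact ⟨l, (Finset.mem_filter.1 hl).1, hαl⟩
    · push Not at hβt
      obtain ⟨l, hl, hlC, hne⟩ := hβt
      refine ⟨l, hl, ?_⟩
      rw [hα l.1 hlC, Bool.eq_not_iff.mpr hne]
  | @query α h x hx _ _ ih0 ih1 =>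
    exact Ev.query x hx (ih0 (hα.update hx _)) (ih1 (hα.update hx _))

/-- **The restricted DNF loses a literal per term**: if every consistent term of the `k`-DNF `F`
has a variable in `C`, then `restrictDNF β C F` is a `(k-1)`-DNF.
[Segerlind–Buss–Impagliazzo 2004, §3] [folklore] -/
theorem isKDNF_restrictDNF {k : ℕ} (hF : IsKDNF k F)
    {C : Finset ℕ} (hcov : ∀ t ∈ F, TConsistent t → ∃ l ∈ t, l.1 ∈ C) (β : ℕ → Bool) :
    IsKDNF (k - 1) (restrictDNF β C F) := by
  intro t' ht'
  obtain ⟨t, ht, rfl⟩ := Finset.mem_image.1 ht'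
  rw [Finset.mem_filter] at ht
  obtain ⟨htF, htc, -⟩ := ht
  obtain ⟨l, hl, hlC⟩ := hcov t htF htc
  have hlt : (t.filter fun l => l.1 ∉ C) ⊂ t :=
    Finset.filter_ssubset.2 ⟨l, hl, by simpa using hlC⟩
  have := Finset.card_lt_card hlt
  have := hF t htF
  omega

/-! ### The cover dichotomy -/

/-- A family of terms is pairwise variable-disjoint. [folklore] -/
def PairwiseDisjointVars (D : Finset (Finset (Literal ℕ))) : Prop :=
  ∀ t ∈ D, ∀ t' ∈ D, t ≠ t' → Disjoint (tvars t) (tvars t')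

/-- **Cover dichotomy**: a DNF not containing the empty term either has `s` pairwise
variable-disjoint consistent terms, or there is a set `C` of fewer than `k·s` variables (for a
`k`-DNF) meeting every consistent term. (Take a pairwise disjoint family of consistent terms of
maximum size; if it is small, the union of its variables is the cover.)
[Segerlind–Buss–Impagliazzo 2004, §3 (Lemma: covering number vs. disjoint terms)] [folklore] -/
theorem exists_disjoint_or_cover {k s : ℕ} (hF : IsKDNF k F) (hempty : (∅ : Finset (Literal ℕ)) ∉ F) :
    (∃ D ⊆ F, D.card = s ∧ PairwiseDisjointVars D ∧ ∀ t ∈ D, TConsistent t) ∨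
    (∃ C : Finset ℕ, C.card ≤ k * s ∧ ∀ t ∈ F, TConsistent t → ∃ l ∈ t, l.1 ∈ C) := by
  classical
  -- a maximum-size pairwise disjoint family of consistent terms
  obtain ⟨D, hDmem, hDmax⟩ := Finset.exists_max_image
    ((F.filter TConsistent).powerset.filter PairwiseDisjointVars) Finset.card
    ⟨∅, by simp [PairwiseDisjointVars]⟩
  rw [Finset.mem_filter, Finset.mem_powerset] at hDmem
  obtain ⟨hDsub, hDdisj⟩ := hDmem
  by_cases hs : s ≤ D.card
  · left
    obtain ⟨D', hD'D, hD'card⟩ := Finset.exists_subset_card_eq hs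
    refine ⟨D', hD'D.trans (hDsub.trans (Finset.filter_subset _ _)), hD'card,
      fun t ht t' ht' hne => hDdisj t (hD'D ht) t' (hD'D ht') hne,
      fun t ht => (Finset.mem_filter.1 (hDsub (hD'D ht))).2⟩
  · right
    push Not at hs
    refine ⟨D.biUnion tvars, ?_, fun t htF htc => ?_⟩
    · calc (D.biUnion tvars).card ≤ ∑ t ∈ D, (tvars t).card := Finset.card_biUnion_le
        _ ≤ ∑ t ∈ D, k := Finset.sum_le_sum fun t ht =>
            (card_tvars_le t).trans (hF t (Finset.mem_filter.1 (hDsub ht)).1)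
        _ = D.card * k := by rw [Finset.sum_const, smul_eq_mul]
        _ ≤ k * s := by rw [mul_comm]; exact Nat.mul_le_mul_left k hs.le
    · by_contra hmeet
      push Not at hmeet
      -- `t` is disjoint from every member of `D`, and not in `D`: adjoin it
      have htD : t ∉ D := by
        intro htD
        have h2 : t.Nonempty := Finset.nonempty_iff_ne_empty.2 (by rintro rfl; exact hempty htF)
        obtain ⟨l, hl⟩ := h2
        exact hmeet l hl (Finset.mem_biUnion.2 ⟨t, htD, mem_tvars.2 ⟨l.2, by simpa using hl⟩⟩)
      have hdisj' : PairwiseDisjointVars (insert t D) := by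
        intro a ha b hb hab
        have key : ∀ u ∈ D, Disjoint (tvars t) (tvars u) := by
          intro u hu
          rw [Finset.disjoint_left]
          intro x hxt hxu
          obtain ⟨b', hb'⟩ := mem_tvars.1 hxt
          exact hmeet _ hb' (Finset.mem_biUnion.2 ⟨u, hu, hxu⟩)
        rcases Finset.mem_insert.1 ha with rfl | haD
        · rcases Finset.mem_insert.1 hb with rfl | hbD
          · exact absurd rfl hab
          · exact key b hbD
        · rcases Finset.mem_insert.1 hb with rfl | hbD
          · exact (key a haD).symm
          · exact hDdisj a haD b hbD hab
      have hmem : insert t D ∈ (F.filter TConsistent).powerset.filter PairwiseDisjointVars := by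
        rw [Finset.mem_filter, Finset.mem_powerset]
        exact ⟨Finset.insert_subset (Finset.mem_filter.2 ⟨htF, htc⟩) hDsub, hdisj'⟩
      have := hDmax _ hmem
      rw [Finset.card_insert_of_notMem htD] at this
      omega

end Summit.PneNP.PneNP.Theorems.ResKRestriction
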